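import Summits.QuantumFields.YangMills.Theorems.BalabanUVNodesK0AxTwoVolumeRate
import Literature.MathematicalPhysics.QuantumFieldTheory.Balaban1983to89.B12Decay510TwoVolume
import Summits.QuantumFields.YangMills.Theorems.BalabanUVNodesK0RecordFormatNamesCentredPair

/-!
# LENS-1 g9 «cauchy-analytic» — JOIN-T v2′: THE TWO-VOLUME KERNEL CLAUSE «⁸'s mould + (D)-road response rows ⇒ [E]», TYPED
(unit `ymgap-nodeO-lens-1-g9`, GEN 9; HOME sketch `nodeO-cover/LENS-1g9-JoinT-v1.lean`, nobody's tree file; count-neutral; director-ym №527 (b) ∕ №526 (iii) re-pointed by ◇ g8)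

[I] = [Balaban1987RG1], [15] = [Balaban1985Variational].

LANDING (porter PTC-1 g3, 2026-08-31): the SORRY-FREE sections of the ideation cell's HOME sketch `nodeO-cover/LENS-1g9-JoinT-v1.1.lean` (sha16 12ba32c4290d3909, 604 l., v1.1 SUPERSEDES v1 per the author 08:06:27Z,
author seat ◇ lens-1 gen 9 «cauchy-analytic», ★★★ director-ym №527 (b)) landed as K0ᴬ helpers `--supports stmt-QuantumFields-27238 --as helper` in THREE files (604 l. > the
400-line cap; ◆ CRIT-1 g36 CUT 08:12:53Z: §A–§E PASS, §K struck as typed): THIS FILE `…K0AxJoinTLeaves.lean` = §A (generic leaves on ✓`B12Decay510TwoVolume`) + §B ((4.37) per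
volume∕colour for every `(μ, ν)`); `…K0AxJoinT.lean` = §C + §D (the two-volume step per colour ∕ in trace form); `…K0AxJoinTRecord.lean` = §E (bookkeeping at the record).  §K — the ONE declared `sorry`, `kstep_joinT_at_record`
(the record instantiation, porter work over ◆ CRIT-1 g36's row list) — is NOT landed (Theorems files are sorry-free); it stays in the HOME sketch.  Declarations and proofs
of §A–§E byte-identical to the sketch; `section Generic` is closed∕re-opened at the file boundary with the same `variable` block.  The author's module docstring follows.

WHAT v2′ IS.  ★★★ №527 (b): «v2′ = JOIN-T kernel clause [R-W] + ◆-admitted (D) response rows (+ P9-reg + (R4ᴰ)′) ⇒ [E]», [E] = `K0AxTwoVolumeRate.RecordPvolTwoVolExpOnRunsAx`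
(✓p814710 :231), [F] := [R-W] verbatim (no new primitive letter).  ◇ g8 located why v2-as-ordered is not constructible (no polymer∕activity level is NAMED below `(Ψ, Ew)`) and why
«[R-W] ⇒ [E]» alone fails (the pieces are evaluated at the VOLUME-DEPENDENT background pair; the two-volume comparison of that pair is (D)-road content).  This file types the
clause at the CHART level — the currency in which the (D) road's JOIN of record ALREADY runs (✓`PortH.decay510_plimOf_of_rows_trace` per volume; [R-W] ⇒ ⁸ is
✓`BalabanUVNodesPortS1.sig27930v8LR4_of_residueAtW`, and ⁸'s consequent `FormatPlusG … R.wrap R.emb R.πc E₀ κ` carries `PieceVolIndep` next to `Analytic19 ∕ Bound118 ∕ Local17 ∕ Repr17 ∕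
GaugeInv119`) — as the TWO-VOLUME SIBLING of that theorem:

  ★★ `abs_polComp_succ_sub_polComp_le_of_rows` (per colour) ∕ ★★★ `twoVol_pvolOf_of_rows_trace` (trace):
  (1.19)-mould pieces `E` (Analytic19, Bound118, Local17, Repr17 at every member, Ward414, PieceVolIndep) ∧ `Chart44D` ∧ (A3) cut ∧ PER-COLOUR rows
  { (R1ᴰ)ₙ gauge decay `hdec`, (R3) `hunwrap`, (R4ᴰ) two-volume gauge comparison on the window `hcmp`, (R5) intertwining `hI` } ∧ the colour-indexed response link `hL` ∧
  THREE GEOMETRIC ROWS { (G0) `emb n` injective off the wrap class; (G1) wrap-class domains are LARGE-OR-FAR from inner-window labels: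
  `Rsep n ≤ dist(e n μ z, X) + Mg·(d_j X + c₁)`; (G2) member-(n+1) domains that are NOT images are LARGE-OR-FAR likewise } ∧ leaves (cube-sum at δ₀∕4, tree at κ∕4)
  ⟹ for inner-window `z`:  `|Πₙ₊₁(μ,z;ν,0) − Πₙ(μ,z;ν,0)| ≤ 48·E₀C₉²K₀K₁·e^{−δ₀Nₙ∕2} + 32·E₀C₉²e^{δ₁Mg c₁}K₀K₁·e^{−δ₁·Rsep n}`, `δ₁ = delta1 δ₀ κ Mg`.

  PROOF = the printed sentence [I] p.264 «This limit exists by the localized representation (1.7)» made quantitative, in three terms (◇ g6 `LENS-1-D4VolumeCauchy-v1.6` §7–§9, INTENT-26):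
  (U) MATCHED PART off the wrap class — SAME Hessian `D²(E_X∘χ_X)(0)` at both members (`PieceVolIndep` + (R5) + `mixedDeriv_comp_clm` = `mixedDeriv_nextMember_eq`), arguments
      near-stable by (R4ᴰ) ((R3) aligns the cut), Cauchy-bilinear in the gauge of the (4.4) domain (`kernelBound_twoVolume_of_gauge`) ⟹ a `KernelBound` with constant ∝ `e^{−δ₀N∕2}`;
  (W₁)(W₂) TAILS — member n's wrap class, member (n+1)'s non-image domains: the single-volume `KernelBound` (✓`B12Decay510Gauge.kernelBound_of_gauge`) MASKED to a LARGE-OR-FAR class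
      (`kernelBound_maskKernel_of_largeOrFar`, NEW: half of each rate pays `e^{−δ₁Rsep}`) — NO «wrap domains are large» claim (a seam cube is small but far; a long domain is near but large);
  all three resummed by ✓`B12Decay510.sum_abs_le` at `δ₁ := 0` (`sum_abs_le_const`); split = `abs_sum_next_sub_sum_le_three`; trace average as in the (5.10) road.
  (4.14) kills the `D(E∘χ)(0)[D²ι]` term, so NO second-order response row is needed (same as the decay road: `ofReal_fderiv_fderiv_eq_sum_mixedDeriv_of_repr`).

§E AT THE RECORD (bookkeeping, sorry-free): `twoRate_le`, `eventually_atTop_of_add`, `recordPvolTwoVolExpOnRunsAx_of_eventually ∕ _of_le_radius ∕ _of_members` (member-indexed two-rate bound + `cR·recordN ≤ Rsep`, `recordN∕4 ≤ recordRNat` ⟹ [E] at rate `δ₁·cR`);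
★★★ `joinConclLimR_of_decayConclR_twoVolExp` — the IN-SCOPE output: the radius-uniform decay JOIN's consequent (✓`PortHRecordJoin.decayConclR_of_texts` shape) carrying, under the
SAME `∃ γ₀ ε₂₉`, the letter [E] at every `γ ≤ γ₀` ⟹ `JoinConclLimR Tok F` (✓`joinConclLimR_of_decayConclR` + ✓`recordPolLimitOnRunsAx_of_twoVolExp`); then K0ᴬ BY NAME is the tree's
✓`decayLetter_of_lim` ∕ ✓`K0AxJoinResidual.record13SepCoPHInhabitedAx_of_lim_residual[_tokFree]` (not restated).  WHY NOT the ✓p814710 :279 door: its `hE` is the TWO-SUPPLIER threshold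
form `∃ εL ∀ ε₂₉ ≤ εL ∃ γ₀ …`, which ⁸∕[R-W] (ONE `∃ γ₀ ε₂₉ …`, `thetaFill ∕ recordW ∕ betaOfRecord₁₃Ax` all ε₂₉-dependent) cannot feed honestly (◇ g9 07:38Z, ■ REF (1348) CONFIRMED).

§K THE ONE NAMED OPEN KERNEL STEP (declared `sorry`): `kstep_joinT_at_record` — ★★★ instantiated at the record names along in-interval runs (member `n` = volume
`recordK₀ F Mc k + n`), in the hypothesis style of ✓`PortHRecordJoin.recordPlimDecayOnRunsAx_of_trace_L` (one dressed chart `ιC` + swap row), typed AGAINST ◆ CRIT-1 g36's price sheet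
`Cruxes/Record13SepCoPHInhabited/CRIT-1-DROWS-v2prime-g36.md`: D1 ⁸'s `FormatPlusG` mould VERBATIM (at `recordEmbJ`), D9 the CENTRED-PAIR receipt ✓`Response9DAtJC` of ★★ DEF-1 ed.19
`…K0RecordFormatNamesCentredPair` (per colour; window `recordRNat`; centred in BOTH blocks — J5′ EXEMPT column), D13 identities (`IotaRowAt`-type for `ιC`, the response link on
`recordGkJC`, the swap row), geometry rows (G0)–(G4) at `recordWrapCtr ∕ recordDomEmbCtr ∕ recordSiteGeom ∕ recordE ∕ recordRNat ∕ recordN` with a DISPLAYED seam separation `Rsep k n ≥ cR·recordN`, leaves at (δ₀∕4, κ∕4);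
NO `…FromCtr ∕ FromJ ∕ FromL`, NO `Response9DAtL ∕ ConsumerC1 ∕ TokP9L4New ∕ TokRest4`, NO `= … univ` bridge (sheet §4 (2)).  ON THE SHEET's §3 «LOCATED GAP G-v2′-1» (second-order
rows): it does NOT arise on this road — (4.14) `Ward414` (from ⁸'s `GaugeInv119` + RowG's `ChartEquivariant ∕ NoInvariantCovector`, ✓`BalabanUVNodesPortS1.ward414_of_gaugeInv119_chart44D`)
kills the `piece′[D²ι]` term inside ✓`B12Eq435SecondVariation.ofReal_fderiv_fderiv_eq_sum_mixedDeriv_of_repr`, so the kernel entry is `Σ_X Re (E_X∘χ_X)″(0)[cut Dι·p, cut Dι·q]` —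
FIRST-ORDER responses only, at both volumes (★ `polComp_eq_sum_re_mixedDeriv_dir`, the `(μ, ν)`-general twin of the (5.10) road's ✓`PortH.polComp_diag_eq_sum_re_mixedDeriv`); the
two-volume defect needed is that of `Dι` ((R4ᴰ), first order), never of `D²ι`.  The sheet's cheapest falsifier («first order right, arbitrary non-decaying second order `U_lin·exp(q(B)T)`»)
is answered by the hypothesis list itself: such a family violates `GaugeInv119`-derived (4.14) or `Repr17` for the SAME pieces, both displayed (⁸); with them, no second-order datum enters.

WHAT ENGINE C ALREADY EXCLUDES ∕ THE NUMBER THAT KEEPS OR KILLS THIS (bus rule): W3 kit j343242 rc 0 measured the two-volume increments of the K=0,1 toy kernels EXP-IN-PERIOD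
(k0: ρ = 0.0487 per blocking, κ_block = 3.021; k1: κ_block = 2.675) — consistent with ★★★'s shape `A·e^{−δ₀N∕2} + B·e^{−δ₁Rsep}` and NOT with a power law; the NEW number is the
R-line «seam dominance»: the ratio of the wrap-class tail (W₁) to the matched part (U) at fixed z as N doubles — ★★★ predicts BOTH decay at rate ≥ min(δ₀∕2, δ₁·Rsep∕N)·N; a measured
(W₁)∕(U) growing like e^{+cN} would kill the LARGE-OR-FAR bookkeeping (G1) at the record (orderable from ttrl7∕ttrl10 by splitting the toy's domain sum at the seam).

HONEST FRAMING.  CONDITIONAL theorems over DISPLAYED row predicates (all hypotheses) + generic folklore; ONE declared `sorry` (§K, the record instantiation = porter work over ◆'s row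
list); nothing of Bałaban ([I] Thm 1, (1.7), (1.18)–(1.22), (4.33)–(4.37), (5.10); [15] Thm 1, Prop. 9, (190)) is asserted, ported, discharged or refuted; [E] inhabited nowhere;
K0⁷ stmt-QuantumFields-20541 ∕ K0ᴬ stmt-QuantumFields-27238 OPEN; NODE O 0∕1; COUNT 8∕28 · K 1∕4 UNMOVED; finite `𝕋⁴_{L^K}` at fixed ε — NOT continuum ∕ ℝ⁴ ∕ OS ∕ Clay;
**the Yang–Mills mass gap is NOT proved by any of this.**  No `instance`, `notation`, `allowUnsafeReducibility`; standard axioms.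
-/

noncomputable section

open Filter Topology
open scoped BigOperators

namespace Summit.QuantumFields.YangMills.Theorems.K0AxJoinT

open Literature.MathematicalPhysics.QuantumFieldTheory.Balaban1983to89
open Literature.MathematicalPhysics.QuantumFieldTheory.Balaban1983to89.Node00 (TermFamily1 siteOfInt polWindow polScalar betaOfRecord₁₃Ax)
open Literature.MathematicalPhysics.QuantumFieldTheory.Balaban1983to89.T4Continuum (T4Family)
open Literature.MathematicalPhysics.QuantumFieldTheory.Balaban1983to89.B12FormatPlus
open Literature.MathematicalPhysics.QuantumFieldTheory.Balaban1983to89.B12Decay510 (SiteGeometry GeomLeaf CubeSumLeaf TreeLeaf KernelBound delta1 mixedDeriv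
  sum_abs_le delta1_le_half delta1_mul_le delta1_nonneg)
open Literature.MathematicalPhysics.QuantumFieldTheory.Balaban1983to89.B12Decay510Gauge (norm_mixedDeriv_le_gauge kernelBound_of_gauge)
open Literature.MathematicalPhysics.QuantumFieldTheory.Balaban1983to89.B12Decay510TwoVolume (kernelBound_twoVolume_of_gauge mixedDeriv_nextMember_eq maskKernel
  sum_filter_abs_eq_sum_abs_maskKernel comapLabels abs_sum_next_sub_sum_le_three)
open Literature.MathematicalPhysics.QuantumFieldTheory.Balaban1983to89.B12Eq435SecondVariation (ofReal_fderiv_fderiv_eq_sum_mixedDeriv_of_repr)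
open Literature.MathematicalPhysics.QuantumFieldTheory.Balaban1983to89.Beta.RemainderLocality (mixedDeriv_comp_clm mixedDeriv_eq_fderiv_fderiv
  differentiableAt_fderiv_of_analyticAt)
open Summit.QuantumFields.YangMills.Theorems.K0RecordFormatNames (ΦfOf pvolOf plimOf)
open Summit.QuantumFields.YangMills.Theorems.PortH (exists_cutTo_clm pvolOf_eq_trace)

/-! ## §A  NEW generic leaves on top of ✓p816011 `B12Decay510TwoVolume` (INTENT-26 = ◇ lens-1 g6 §7–§9): the LARGE-OR-FAR mask, label restriction of the cube-sum leaf, rate monotonicity of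
the tree leaf, resummation without distance gain, two `cutTo` identities -/

section Leaves

variable {S : LocDomainSys} {C : B12.CubeCover S} {Λ : Type*}

/-- ★ **LARGE-OR-FAR TAIL** (NEW, replaces g6's separate «large» ∕ «far» masks — a seam cube is SMALL but FAR, a long domain NEAR but LARGE): on a class where every label `x`
satisfies `Rsep ≤ dist(x, X) + Mg·(d_j(X) + c₁)` (the triangle inequality through `X` to a seam cube), HALF of each rate pays for `e^{−δ₁Rsep}`
(`δ₁ ≤ δ₀∕2`, `δ₁Mg ≤ κ∕2`): the masked kernel obeys `KernelBound` with constant `CE·e^{δ₁Mg c₁}·e^{−δ₁Rsep}` at rates `(κ∕2, δ₀∕2)`.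
[cite: Balaban1987RG1, §0 p.257, (1.18) p.263, (4.5) p.282, (1.21) p.264] -/
theorem kernelBound_maskKernel_of_largeOrFar (G : SiteGeometry C Λ) {E2 : S.Dom → Λ → Λ → ℝ} {CE κ δ₀ δ₁ Mg c₁ Rsep : ℝ} (hCE : 0 ≤ CE)
    (hδ₁ : 0 ≤ δ₁) (hδ₁δ₀ : δ₁ ≤ δ₀ / 2) (hδ₁κ : δ₁ * Mg ≤ κ / 2)
    (hE : KernelBound G E2 CE κ δ₀) (P : S.Dom → Prop) [DecidablePred P] (hP : ∀ X, P X → ∀ x : Λ, Rsep ≤ G.distD x X + Mg * (S.dj X + c₁)) :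
    KernelBound G (maskKernel E2 P) (CE * Real.exp (δ₁ * Mg * c₁) * Real.exp (-δ₁ * Rsep)) (κ / 2) (δ₀ / 2) := by
  intro X x y
  unfold maskKernel
  split_ifs with hX
  · have hd := S.dj_nonneg X
    have ha := G.distD_nonneg x X
    have hb := G.distD_nonneg y X
    have hsep := hP X hX x
    have hδ₀ : 0 ≤ δ₀ := by linarith
    have h1 : δ₁ * G.distD x X ≤ δ₀ / 2 * G.distD x X := mul_le_mul_of_nonneg_right hδ₁δ₀ ha
    have h2 : δ₁ * Mg * S.dj X ≤ κ / 2 * S.dj X := mul_le_mul_of_nonneg_right hδ₁κ hd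
    have h3 : δ₁ * Rsep ≤ δ₁ * G.distD x X + δ₁ * Mg * S.dj X + δ₁ * Mg * c₁ := by
      calc δ₁ * Rsep ≤ δ₁ * (G.distD x X + Mg * (S.dj X + c₁)) := mul_le_mul_of_nonneg_left hsep hδ₁
        _ = δ₁ * G.distD x X + δ₁ * Mg * S.dj X + δ₁ * Mg * c₁ := by ring
    have h4 : 0 ≤ δ₀ / 2 * G.distD y X := mul_nonneg (by linarith) hb
    have key : -κ * S.dj X + -δ₀ * G.distD x X + -δ₀ * G.distD y X ≤
        δ₁ * Mg * c₁ + -δ₁ * Rsep + (-(κ / 2) * S.dj X + -(δ₀ / 2) * G.distD x X + -(δ₀ / 2) * G.distD y X) := by linarith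
    calc |E2 X x y| ≤ CE * Real.exp (-κ * S.dj X) * Real.exp (-δ₀ * G.distD x X) * Real.exp (-δ₀ * G.distD y X) := hE X x y
      _ = CE * Real.exp (-κ * S.dj X + -δ₀ * G.distD x X + -δ₀ * G.distD y X) := by rw [Real.exp_add, Real.exp_add]; ring
      _ ≤ CE * Real.exp (δ₁ * Mg * c₁ + -δ₁ * Rsep + (-(κ / 2) * S.dj X + -(δ₀ / 2) * G.distD x X + -(δ₀ / 2) * G.distD y X)) :=
          mul_le_mul_of_nonneg_left (Real.exp_le_exp.2 key) hCE
      _ = CE * Real.exp (δ₁ * Mg * c₁) * Real.exp (-δ₁ * Rsep) * Real.exp (-(κ / 2) * S.dj X) * Real.exp (-(δ₀ / 2) * G.distD x X) *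
            Real.exp (-(δ₀ / 2) * G.distD y X) := by rw [Real.exp_add, Real.exp_add, Real.exp_add, Real.exp_add]; ring
  · rw [abs_zero]
    exact mul_nonneg (mul_nonneg (mul_nonneg (mul_nonneg (mul_nonneg hCE (Real.exp_pos _).le) (Real.exp_pos _).le) (Real.exp_pos _).le)
      (Real.exp_pos _).le) (Real.exp_pos _).le

/-- The cube-sum leaf restricts along the labels. [cite: Balaban1987RG1, (5.10) p.293 (bookkeeping)] -/
theorem cubeSumLeaf_comapLabels {Λ₀ : Type*} (G : SiteGeometry C Λ) (f : Λ₀ → Λ) {a K₁ : ℝ} (h : CubeSumLeaf G a K₁) :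
    CubeSumLeaf (comapLabels G f) a K₁ :=
  fun x => h (f x)

/-- The tree leaf is monotone in the rate (halving the rate keeps the constant). [cite: Balaban1987RG1, (0.26) pp.257–258 (bookkeeping)] -/
theorem treeLeaf_of_le (C : B12.CubeCover S) {κ κ' K₀ : ℝ} (hκ : κ' ≤ κ) (h : TreeLeaf C κ' K₀) : TreeLeaf C κ K₀ := by
  intro c
  refine (Finset.sum_le_sum fun X _ => Real.exp_le_exp.2 ?_).trans (h c)
  have := S.dj_nonneg X
  nlinarith

/-- **Resummation with NO distance gain** (`δ₁ := 0` in ✓`B12Decay510.sum_abs_le`): a `KernelBound` at rates `(κ, δ₀)` with the cube-sum leaf at `δ₀∕2` and the tree leaf at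
`κ∕2` ⟹ `Σ_X |E2 X x y| ≤ CE·K₀·K₁` for every pair of labels. [cite: Balaban1987RG1, (5.10) p.293, (0.26) p.257] -/
theorem sum_abs_le_const (G : SiteGeometry C Λ) {E2 : S.Dom → Λ → Λ → ℝ} {CE κ δ₀ K₀ K₁ : ℝ} (hCE : 0 ≤ CE) (hK₀ : 0 ≤ K₀)
    (hκ : 0 ≤ κ) (hδ₀ : 0 ≤ δ₀) (hE : KernelBound G E2 CE κ δ₀) (hcube : CubeSumLeaf G (δ₀ / 2) K₁) (htree : TreeLeaf C (κ / 2) K₀) (x y : Λ) :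
    ∑ X, |E2 X x y| ≤ CE * K₀ * K₁ := by
  have hgeo : GeomLeaf G (fun _ _ => (0 : ℝ)) 1 0 := fun X x' y' => by
    have := G.distD_nonneg x' X; have := G.distD_nonneg y' X; have := S.dj_nonneg X
    linarith
  have h := sum_abs_le G (ρ := fun _ _ => (0 : ℝ)) (δ₁ := 0) (M := 1) (c₁ := 0) hCE hK₀ le_rfl (by linarith) (by linarith) hE hgeo hcube htree x y
  simpa using h

/-- `cutTo` is additive-linear: the cut of a difference is the difference of the cuts. [cite: Balaban1987RG1, (4.35) p.290 (bookkeeping)] -/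
theorem cutTo_sub {m₁ : ℕ} (cX : Finset (Fin m₁)) (u v : Fin m₁ → ℂ) : cutTo cX u - cutTo cX v = cutTo cX (u - v) := by
  funext i
  simp only [Pi.sub_apply, cutTo_apply]
  split_ifs <;> simp

/-- (R3) bookkeeping: pulling member `n + 1`'s cut response back through `restrictCLM` IS the cut of the lifted coordinates. [cite: Balaban1987RG1, (1.7) p.261 with (1.21) p.264 (bookkeeping)] -/
theorem restrictCLM_cutTo_of_unwrap {m₁ m₂ : ℕ} (cX : Finset (Fin m₁)) (cX' : Finset (Fin m₂)) (j : Fin m₁ → Fin m₂)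
    (hj : ∀ i ∈ cX, j i ∈ cX') (u : Fin m₂ → ℂ) :
    restrictCLM cX j (cutTo cX' u) = cutTo cX fun i => u (j i) := by
  funext i
  rw [restrictCLM_apply, cutTo_apply, cutTo_apply]
  by_cases hi : i ∈ cX
  · rw [if_pos hi, if_pos hi, if_pos (hj i hi)]
  · rw [if_neg hi, if_neg hi]

end Leaves

/-! ## §B  (4.37) per volume and per colour for EVERY direction pair `(μ, ν)` (✓`PortH.polComp_diag_eq_sum_re_mixedDeriv` is the `(0, 1)` instance; same proof) -/

section Generic

variable (F : T4Family) {𝔄 : Type} [NormedRing 𝔄] [NormedAlgebra ℝ 𝔄] {V : Type} [NormedAddCommGroup V] [NormedSpace ℝ V] {ι : Type} [Fintype ι]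
  (fam : TermFamily1 F 𝔄) (ρ : V →L[ℝ] 𝔄) (bV : Module.Basis ι ℝ V) (k : ℕ) (v : Fin (k + 1) → ℝ)
  {S : ℕ → LocDomainSys} {M m : ℕ → ℕ}

omit [Fintype ι] in
/-- ★ **(4.37) PER VOLUME, PER COLOUR, EVERY `(μ, ν)`**: `Π^{aa}_{μν}(z, 0) = Σ_X Re ∂²(𝐄ₙ(X)∘χ_X)[cut h(e ν 0), cut h(e μ z)]`. [cite: Balaban1987RG1, (4.35) p.290, (4.37) p.291, (1.20) p.264, (1.7) p.261] -/
theorem polComp_eq_sum_re_mixedDeriv_dir (Uc : (n : ℕ) → (S n).Dom → Set (Fin (M n) → ℂ)) (coords : (n : ℕ) → (S n).Dom → Finset (Fin (M n)))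
    (χ : (n : ℕ) → (S n).Dom → (Fin (m n) → ℂ) → (Fin (M n) → ℂ)) (D : (n : ℕ) → (S n).Dom → Set (Fin (m n) → ℂ))
    (E : Pieces S M) (R : Response9Data S M m 4) (K : ℕ → ℕ) (Gc : (n : ℕ) → ι → R.Λ n → (Fin (m n) → ℂ))
    (ιe : (n : ℕ) → (Fin (F.P (K n)).d → Site (F.P (K n)) (k + 1) → V) → (Fin (m n) → ℂ))
    (hAn : Analytic19 Uc E) (hLoc : Local17 coords E) (hRep : Repr17 S E χ (fun n => ΦfOf F fam ρ k v (K n)) ιe) (hW : Ward414 χ E)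
    (hC : Chart44D S M Uc m χ D) (hcut : ∀ n X u, ∀ i ∈ coords n X, χ n X (cutTo (R.cX n X) u) i = χ n X u i)
    (hL : ∀ n, ιe n 0 = 0 ∧ ContDiffAt ℝ 2 (ιe n) 0 ∧ ∀ (a : ι) (μ : Fin 4) (z : Fin 4 → ℤ),
      Gc n a (R.e n μ z) = fderiv ℝ (ιe n) 0 (Pi.single (Fin.cast (F.P_d (K n)).symm μ) (Pi.single (siteOfInt F (K n) (k + 1) z) (bV a))))
    (n : ℕ) (a : ι) (μ ν : Fin 4) (z : Fin 4 → ℤ) :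
    B12PolarizationTensor120.polComp ℝ (B12PolarizationTensor120.expChart (fam k v (K n)) ρ) bV (Fin.cast (F.P_d (K n)).symm μ) (siteOfInt F (K n) (k + 1) z) a
        (Fin.cast (F.P_d (K n)).symm ν) (siteOfInt F (K n) (k + 1) 0) a =
      ∑ X, (mixedDeriv (fun u => E n X (χ n X u)) (cutTo (R.cX n X) (Gc n a (R.e n ν 0))) (cutTo (R.cX n X) (Gc n a (R.e n μ z)))).re := by
  classical
  obtain ⟨hι0, hιC2, hGk⟩ := hL n
  have hF : ∀ X, AnalyticAt ℂ (fun u => E n X (χ n X u)) 0 := fun X => by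
    obtain ⟨-, -, -, h0, hχan, hmaps⟩ := hC n X
    exact (hAn n X (χ n X 0) (hmaps h0)).comp (hχan 0 h0)
  have hrepr : (fun B => ((B12PolarizationTensor120.expChart (fam k v (K n)) ρ B : ℝ) : ℂ)) =ᶠ[𝓝 0]
      fun B => ∑ X, (fun u => E n X (χ n X u)) (ιe n B) := hRep n
  set p : Fin (F.P (K n)).d → Site (F.P (K n)) (k + 1) → V := Pi.single (Fin.cast (F.P_d (K n)).symm μ) (Pi.single (siteOfInt F (K n) (k + 1) z) (bV a)) with hp
  set q : Fin (F.P (K n)).d → Site (F.P (K n)) (k + 1) → V := Pi.single (Fin.cast (F.P_d (K n)).symm ν) (Pi.single (siteOfInt F (K n) (k + 1) 0) (bV a)) with hq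
  have hbridge := (ofReal_fderiv_fderiv_eq_sum_mixedDeriv_of_repr (fun X u => E n X (χ n X u)) (ιe n) _ hrepr hι0 hιC2 hF (hW n) p q).2
  have hpc : ((B12PolarizationTensor120.polComp ℝ (B12PolarizationTensor120.expChart (fam k v (K n)) ρ) bV (Fin.cast (F.P_d (K n)).symm μ)
      (siteOfInt F (K n) (k + 1) z) a (Fin.cast (F.P_d (K n)).symm ν) (siteOfInt F (K n) (k + 1) 0) a : ℝ) : ℂ) =
      ∑ X, mixedDeriv (fun u => E n X (χ n X u)) (fderiv ℝ (ιe n) 0 q) (fderiv ℝ (ιe n) 0 p) := hbridge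
  rw [← hGk a ν 0, ← hGk a μ z] at hpc
  have hcutEq : ∀ X (a' b' : Fin (m n) → ℂ), mixedDeriv (fun u => E n X (χ n X u)) a' b' =
      mixedDeriv (fun u => E n X (χ n X u)) (cutTo (R.cX n X) a') (cutTo (R.cX n X) b') := by
    intro X a' b'
    obtain ⟨T, hT⟩ := exists_cutTo_clm (R.cX n X)
    have hfun : (fun u => E n X (χ n X u)) = fun u => (fun u => E n X (χ n X u)) (T u) := by
      funext u; rw [hT]; exact (hLoc n X _ _ fun i hi => (hcut n X u i hi)).symm
    obtain ⟨r, hr, hball⟩ : ∃ r > 0, ∀ y ∈ Metric.ball (0 : Fin (m n) → ℂ) r, DifferentiableAt ℂ (fun u => E n X (χ n X u)) y := by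
      obtain ⟨s, hs, hsub⟩ := Metric.mem_nhds_iff.1 (hF X).eventually_analyticAt
      exact ⟨s, hs, fun y hy => (hsub hy).differentiableAt⟩
    conv_lhs => rw [hfun]
    rw [mixedDeriv_comp_clm hr hball T a' b', hT, hT]
  rw [Finset.sum_congr rfl fun X _ => hcutEq X _ _] at hpc
  have := congrArg Complex.re hpc
  rw [Complex.ofReal_re, Complex.re_sum] at this
  exact this

end Generic

end Summit.QuantumFields.YangMills.Theorems.K0AxJoinT

end
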